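import Mathlib.Topology.Algebra.Group.OpenMapping
import Mathlib.Topology.Baire.LocallyCompactRegular
import Literature.NumberTheory.Automorphic.SmoothIndCellFunCompactSupport
import HarnessLib

/-!
# Compact subsets of the open cell are compact in the `N`-direction (open mapping theorem), and compact support of cell functions

Topic `NumberTheory/Automorphic`; namespace `Literature.NumberTheory.Automorphic`.  THEOREMS ONLY: no definition, no named
fact, no `sorry`, no instance declaration, no notation.  Sequel of ★ `SmoothIndCellFunCompactSupport`: there the compact
support of the cell function `γ ↦ f (w₀ ι(γ))` of a section `f ∈ Ind_H^G σ` vanishing at `1` was proved under the hypothesis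
(Br) «every compact subset of `G` avoiding `H` lies in `H · w₀ · ι(D)` for a compact `D ⊆ Γ`».  Here (Br) is PROVED from
purely topological–group-theoretic data by the open mapping theorem for `σ`-compact groups acting transitively on Baire spaces
(Mathlib `isOpenMap_smul_of_sigmaCompact`) — the abstract form of ★ `ParabolicBruhatCellSupport`
(`exists_isCompact_subset_parabolic_mul_permGL_mul` for `GL_n`), [BernsteinZelevinsky1977, §5.14] («for an `l`-group countable
at infinity acting transitively, the orbit is homeomorphic to the quotient», from [BernsteinZelevinsky1976, §1.5]).

## Hypotheses and results

`G` a locally compact Hausdorff topological group, `H ≤ G` a CLOSED subgroup, `Γ` a topological group, `ι : Γ →* G`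
continuous, `w₀ ∈ G`, with `↥H` and `Γ` `σ`-compact, and the TWO-CELL structure
* (cell) every `g ∉ H` is `h · w₀ · ι(γ)` (`h ∈ H`, `γ ∈ Γ`);
* (disj) `h · w₀ · ι(γ) ∉ H` (the two cells are disjoint).
Then `H × Γ` acts continuously and transitively on the open cell `X = G ∖ H` (locally compact Hausdorff, hence Baire) by
`(h, γ) · x = h x ι(γ)⁻¹`, so:
* `isOpenMap_openCellOrbit` — the orbit map `(h, γ) ↦ h w₀ ι(γ)⁻¹ : ↥H × Γ → G` is OPEN;
* `exists_isCompact_cellCoord_of_sigmaCompact` — (Br): a compact `C ⊆ G ∖ H` lies in `H w₀ ι(D)`, `D ⊆ Γ` compact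
  (`Γ` weakly locally compact: cover `C` by the open pieces `H w₀ ι(γ V)`, `V` a compact neighbourhood of `1`);
* `SmoothInd.hasCompactSupport_cellFun_of_sigmaCompact` — with the Iwasawa decomposition `G = H · K₀` (`K₀` compact) and the
  uniqueness of the `Γ`-coordinate, the cell function of every `f ∈ Ind_H^G σ` with `f(1) = 0` is compactly supported
  (★ `SmoothInd.hasCompactSupport_cellFun_of_toFun_one_eq_zero`).
For `U(Φ₃)(L⁺_v)` at a non-split place all hypotheses are ★ (F1 `U3LocalBruhatDecompositionProofs`, Iwasawa
`exists_borel_mul_mem_cmLocalIntegralLevel`, `isCompact_isOpen_cmLocalIntegralLevel`, `isClosed_borelU`); no coordinates, no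
valuations, no Haar measure enter.  HC_CM is proved only modulo the printed citations until rung 0 closes; this file discharges
no named fact.

## References
* [BernsteinZelevinsky1977] I. N. Bernstein, A. V. Zelevinsky, *Induced representations of reductive `p`-adic groups. I*,
  Ann. Sci. ÉNS (4) 10 (1977), §5.14, §5 (proof of Thm. 5.2).
* [BernsteinZelevinsky1976] I. N. Bernstein, A. V. Zelevinsky, *Representations of the group `GL(n,F)` where `F` is a
  non-archimedean local field*, Russian Math. Surveys 31:3 (1976), §1.5.
* [Casselman1995] W. Casselman, *Introduction to the theory of admissible representations of `p`-adic reductive groups*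
  (draft 1 May 1995), Prop. 1.3.1–1.3.3, Prop. 6.3.1.
* Mathlib, `isOpenMap_smul_of_sigmaCompact`.
-/

set_option autoImplicit false

open scoped Pointwise
open Topology

namespace Literature.NumberTheory.Automorphic

section OpenMapping

variable {G : Type*} [Group G] [TopologicalSpace G] [IsTopologicalGroup G] {H : Subgroup G}
  {Γ : Type*} [Group Γ] [TopologicalSpace Γ] [IsTopologicalGroup Γ] (ι : Γ →* G) (w₀ : G)

/-- **the orbit map of `H × Γ` on the open cell is open** ([BernsteinZelevinsky1977, §5.14]; Mathlib's open mapping theorem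
`isOpenMap_smul_of_sigmaCompact`): `G` locally compact Hausdorff, `H` closed, `↥H` and `Γ` `σ`-compact, `ι` continuous,
`G ∖ H = H w₀ ι(Γ)` with `H w₀ ι(Γ) ∩ H = ∅`; then `(h, γ) ↦ h · w₀ · ι(γ)⁻¹ : ↥H × Γ → G` is an open map.
[cite: BernsteinZelevinsky1977, §5.14] -/
theorem isOpenMap_openCellOrbit [LocallyCompactSpace G] [T2Space G] [SigmaCompactSpace ↥H] [SigmaCompactSpace Γ]
    (hH : IsClosed (H : Set G)) (hι : Continuous ι)
    (hcell : ∀ g : G, g ∉ H → ∃ h ∈ H, ∃ γ : Γ, g = h * w₀ * ι γ)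
    (hdisj : ∀ h ∈ H, ∀ γ : Γ, h * w₀ * ι γ ∉ H) :
    IsOpenMap fun p : ↥H × Γ => (p.1 : G) * w₀ * ι p.2⁻¹ := by
  classical
  -- the open cell `X = G ∖ H`, locally compact Hausdorff hence Baire
  have hXo : IsOpen {g : G | g ∉ H} := hH.isOpen_compl
  haveI : LocallyCompactSpace {g : G // g ∉ H} := hXo.locallyCompactSpace
  haveI : BaireSpace {g : G // g ∉ H} := BaireSpace.of_t2Space_locallyCompactSpace
  -- the action `(h, γ) · x = h x ι(γ)⁻¹` preserves the open cell
  have hstab : ∀ (p : ↥H × Γ) (x : {g : G // g ∉ H}), (p.1 : G) * x * ι p.2⁻¹ ∉ H := by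
    rintro ⟨h, δ⟩ ⟨x, hx⟩
    obtain ⟨h', hh', γ, rfl⟩ := hcell x hx
    have : (h : G) * (h' * w₀ * ι γ) * ι δ⁻¹ = (h * h') * w₀ * ι (γ * δ⁻¹) := by
      rw [map_mul]; simp only [mul_assoc]
    rw [this]
    exact hdisj _ (H.mul_mem h.2 hh') _
  letI : MulAction (↥H × Γ) {g : G // g ∉ H} :=
    { smul := fun p x => ⟨(p.1 : G) * x * ι p.2⁻¹, hstab p x⟩
      one_smul := fun x => Subtype.ext (by
        change ((1 : ↥H) : G) * (x : G) * ι (1 : Γ)⁻¹ = x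
        simp)
      mul_smul := fun p q x => Subtype.ext (by
        change ((p.1 * q.1 : ↥H) : G) * (x : G) * ι (p.2 * q.2)⁻¹ = (p.1 : G) * ((q.1 : G) * x * ι q.2⁻¹) * ι p.2⁻¹
        rw [Subgroup.coe_mul, mul_inv_rev, map_mul]
        simp only [mul_assoc]) }
  have hsmul : ∀ (p : ↥H × Γ) (x : {g : G // g ∉ H}), ((p • x : {g : G // g ∉ H}) : G) = (p.1 : G) * x * ι p.2⁻¹ :=
    fun _ _ => rfl
  haveI : ContinuousSMul (↥H × Γ) {g : G // g ∉ H} := by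
    refine ⟨Continuous.subtype_mk ?_ _⟩
    exact ((continuous_subtype_val.comp (continuous_fst.comp continuous_fst)).mul
      (continuous_subtype_val.comp continuous_snd)).mul
        (hι.comp ((continuous_snd.comp continuous_fst).inv))
  haveI : MulAction.IsPretransitive (↥H × Γ) {g : G // g ∉ H} := by
    refine ⟨fun x y => ?_⟩
    obtain ⟨h₁, hh₁, γ₁, hx⟩ := hcell x.1 x.2
    obtain ⟨h₂, hh₂, γ₂, hy⟩ := hcell y.1 y.2
    refine ⟨(⟨h₂ * h₁⁻¹, H.mul_mem hh₂ (H.inv_mem hh₁)⟩, γ₂⁻¹ * γ₁), Subtype.ext ?_⟩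
    rw [hsmul]
    change h₂ * h₁⁻¹ * (x : G) * ι (γ₂⁻¹ * γ₁)⁻¹ = y
    rw [hx, hy, mul_inv_rev, inv_inv, map_mul]
    have : h₂ * h₁⁻¹ * (h₁ * w₀ * ι γ₁) * (ι γ₁⁻¹ * ι γ₂) = h₂ * w₀ * (ι γ₁ * ι γ₁⁻¹) * ι γ₂ := by group
    rw [this, ← map_mul, mul_inv_cancel, map_one, mul_one]
  haveI : SigmaCompactSpace (↥H × Γ) := inferInstance
  haveI : IsTopologicalGroup (↥H × Γ) := inferInstance
  -- the base point `w₀ ∈ X` and the open orbit map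
  have hw₀ : w₀ ∉ H := by simpa using hdisj 1 H.one_mem 1
  have horb : IsOpenMap fun p : ↥H × Γ => p • (⟨w₀, hw₀⟩ : {g : G // g ∉ H}) :=
    isOpenMap_smul_of_sigmaCompact _
  have hval : IsOpenMap (Subtype.val : {g : G // g ∉ H} → G) := hXo.isOpenMap_subtype_val
  have hfun : (fun p : ↥H × Γ => (p.1 : G) * w₀ * ι p.2⁻¹) =
      Subtype.val ∘ fun p : ↥H × Γ => p • (⟨w₀, hw₀⟩ : {g : G // g ∉ H}) := funext fun p => rfl
  rw [hfun]
  exact hval.comp horb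

/-- **(Br) compact subsets of the open cell are compact in the `N`-direction** ([BernsteinZelevinsky1977, §5.14]; the abstract
form of ★ `exists_isCompact_subset_parabolic_mul_permGL_mul`): under the hypotheses of `isOpenMap_openCellOrbit` and `Γ`
weakly locally compact, every compact `C ⊆ G` avoiding `H` lies in `H · w₀ · ι(D)` for a compact `D ⊆ Γ` (cover `C` by the
open pieces `H w₀ ι(γ V)`, `V` a compact neighbourhood of `1` in `Γ`, and take a finite subcover).
[cite: BernsteinZelevinsky1977, §5.14] [cite: Casselman1995, Prop. 1.3.3] -/
theorem exists_isCompact_cellCoord_of_sigmaCompact [LocallyCompactSpace G] [T2Space G] [SigmaCompactSpace ↥H]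
    [SigmaCompactSpace Γ] [WeaklyLocallyCompactSpace Γ]
    (hH : IsClosed (H : Set G)) (hι : Continuous ι)
    (hcell : ∀ g : G, g ∉ H → ∃ h ∈ H, ∃ γ : Γ, g = h * w₀ * ι γ)
    (hdisj : ∀ h ∈ H, ∀ γ : Γ, h * w₀ * ι γ ∉ H)
    (C : Set G) (hC : IsCompact C) (hCH : ∀ g ∈ C, g ∉ H) :
    ∃ D : Set Γ, IsCompact D ∧ ∀ g ∈ C, ∃ h ∈ H, ∃ γ ∈ D, g = h * w₀ * ι γ := by
  classical
  have horb := isOpenMap_openCellOrbit ι w₀ hH hι hcell hdisj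
  -- a compact neighbourhood `V` of `1` in `Γ` and the open pieces `H w₀ ι((γ V)⁻¹)⁻¹ = H w₀ ι(…)`
  obtain ⟨V, hVc, hV1⟩ := exists_compact_mem_nhds (1 : Γ)
  -- piece indexed by `γ`: the image of `H × {δ | δ⁻¹ ∈ γ • V}` i.e. `δ` with `γ⁻¹ δ⁻¹ ∈ V`
  have hSo : ∀ γ : Γ, IsOpen {δ : Γ | γ⁻¹ * δ⁻¹ ∈ interior V} := fun γ =>
    isOpen_interior.preimage ((continuous_const.mul continuous_inv))
  have hpiece : ∀ γ : Γ, IsOpen ((fun p : ↥H × Γ => (p.1 : G) * w₀ * ι p.2⁻¹) ''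
      ((Set.univ : Set ↥H) ×ˢ {δ : Γ | γ⁻¹ * δ⁻¹ ∈ interior V})) := fun γ =>
    horb _ (isOpen_univ.prod (hSo γ))
  -- the pieces cover `C`
  have hcover : C ⊆ ⋃ γ : Γ, (fun p : ↥H × Γ => (p.1 : G) * w₀ * ι p.2⁻¹) ''
      ((Set.univ : Set ↥H) ×ˢ {δ : Γ | γ⁻¹ * δ⁻¹ ∈ interior V}) := by
    intro g hg
    obtain ⟨h, hh, γ, rfl⟩ := hcell g (hCH g hg)
    refine Set.mem_iUnion.2 ⟨γ, ⟨(⟨h, hh⟩, γ⁻¹), ⟨Set.mem_univ _, ?_⟩, ?_⟩⟩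
    · show γ⁻¹ * γ⁻¹⁻¹ ∈ interior V
      rw [inv_inv, inv_mul_cancel]
      exact mem_interior_iff_mem_nhds.2 hV1
    · show (h : G) * w₀ * ι γ⁻¹⁻¹ = h * w₀ * ι γ
      rw [inv_inv]
  obtain ⟨T, hT⟩ := hC.elim_finite_subcover _ hpiece hcover
  -- `D = ⋃_{γ ∈ T} γ • V` is compact
  refine ⟨⋃ γ ∈ T, (fun δ : Γ => γ * δ) '' V, T.isCompact_biUnion fun γ _ => hVc.image (continuous_const.mul continuous_id),
    fun g hg => ?_⟩
  obtain ⟨γ, hγT, hgγ⟩ : ∃ γ ∈ T, g ∈ (fun p : ↥H × Γ => (p.1 : G) * w₀ * ι p.2⁻¹) ''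
      ((Set.univ : Set ↥H) ×ˢ {δ : Γ | γ⁻¹ * δ⁻¹ ∈ interior V}) := by
    simpa only [Set.mem_iUnion, exists_prop] using hT hg
  obtain ⟨⟨h, δ⟩, ⟨-, hδ⟩, rfl⟩ := hgγ
  refine ⟨h, h.2, δ⁻¹, Set.mem_biUnion hγT ⟨γ⁻¹ * δ⁻¹, interior_subset hδ, ?_⟩, rfl⟩
  show γ * (γ⁻¹ * δ⁻¹) = δ⁻¹
  rw [mul_inv_cancel_left]

end OpenMapping

section Support

variable {k : Type*} [CommRing k] {G : Type*} [Group G] [TopologicalSpace G] [IsTopologicalGroup G] {H : Subgroup G}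
  {W : Type*} [AddCommGroup W] [Module k W] {σ : Representation k H W}
  {Γ : Type*} [Group Γ] [TopologicalSpace Γ] [IsTopologicalGroup Γ] (ι : Γ →* G) (w₀ : G)

/-- **COMPACT SUPPORT OF THE CELL FUNCTION FROM IWASAWA + TWO DISJOINT CELLS (no coordinates)** ([BernsteinZelevinsky1977, §5];
[Casselman1995, §6.3]): `G` locally compact Hausdorff, `H ≤ G` closed, `↥H` and `Γ` `σ`-compact, `Γ` weakly locally compact,
`ι : Γ →* G` continuous; (Iw) `G = H · K₀` with `K₀` compact; (cell) `G ∖ H = H w₀ ι(Γ)`; (disj) `H w₀ ι(Γ) ∩ H = ∅`;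
(Un) `h w₀ ι(γ) = w₀ ι(γ') ⟹ γ = γ'`.  Then for every `f ∈ Ind_H^G σ` with `f(1) = 0` the cell function `γ ↦ f (w₀ ι(γ))`
has compact support (★ `SmoothInd.hasCompactSupport_cellFun_of_toFun_one_eq_zero` with (Br) supplied by
`exists_isCompact_cellCoord_of_sigmaCompact`).  At `U(Φ₃)(L⁺_v)`, `v` non-split, every hypothesis is a ★ theorem.
[cite: BernsteinZelevinsky1977, §5 (proof of Thm. 5.2)] [cite: Casselman1995, Prop. 6.3.1] -/
theorem SmoothInd.hasCompactSupport_cellFun_of_sigmaCompact [LocallyCompactSpace G] [T2Space G] [SigmaCompactSpace ↥H]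
    [SigmaCompactSpace Γ] [WeaklyLocallyCompactSpace Γ]
    (hH : IsClosed (H : Set G)) (hι : Continuous ι) {K₀ : Set G} (hK₀ : IsCompact K₀)
    (hIw : ∀ g : G, ∃ h ∈ H, ∃ κ ∈ K₀, g = h * κ)
    (hcell : ∀ g : G, g ∉ H → ∃ h ∈ H, ∃ γ : Γ, g = h * w₀ * ι γ)
    (hdisj : ∀ h ∈ H, ∀ γ : Γ, h * w₀ * ι γ ∉ H)
    (hUn : ∀ h ∈ H, ∀ γ γ' : Γ, h * w₀ * ι γ = w₀ * ι γ' → γ = γ')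
    (f : Representation.SmoothInd H σ) (hf : f.toFun 1 = 0) :
    HasCompactSupport fun γ => f.toFun (w₀ * ι γ) :=
  SmoothInd.hasCompactSupport_cellFun_of_toFun_one_eq_zero ι w₀ hK₀ hIw
    (exists_isCompact_cellCoord_of_sigmaCompact ι w₀ hH hι hcell hdisj) hUn f hf

/-- the same, returning the compact set: `∃ D` compact with `f (w₀ ι γ) ≠ 0 → γ ∈ D`. [cite: BernsteinZelevinsky1977, §5 (proof of Thm. 5.2)] -/
theorem SmoothInd.exists_isCompact_forall_cellFun_ne_zero_mem_of_sigmaCompact [LocallyCompactSpace G] [T2Space G]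
    [SigmaCompactSpace ↥H] [SigmaCompactSpace Γ] [WeaklyLocallyCompactSpace Γ]
    (hH : IsClosed (H : Set G)) (hι : Continuous ι) {K₀ : Set G} (hK₀ : IsCompact K₀)
    (hIw : ∀ g : G, ∃ h ∈ H, ∃ κ ∈ K₀, g = h * κ)
    (hcell : ∀ g : G, g ∉ H → ∃ h ∈ H, ∃ γ : Γ, g = h * w₀ * ι γ)
    (hdisj : ∀ h ∈ H, ∀ γ : Γ, h * w₀ * ι γ ∉ H)
    (hUn : ∀ h ∈ H, ∀ γ γ' : Γ, h * w₀ * ι γ = w₀ * ι γ' → γ = γ')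
    (f : Representation.SmoothInd H σ) (hf : f.toFun 1 = 0) :
    ∃ D : Set Γ, IsCompact D ∧ ∀ γ : Γ, f.toFun (w₀ * ι γ) ≠ 0 → γ ∈ D :=
  SmoothInd.exists_isCompact_forall_cellFun_ne_zero_mem ι w₀ hK₀ hIw
    (exists_isCompact_cellCoord_of_sigmaCompact ι w₀ hH hι hcell hdisj) hUn f hf

end Support

end Literature.NumberTheory.Automorphic
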